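import Summits.Schanuel.Schanuel.Theorems.DiophantineDichotomyApproximationPropertyBoxModIdeal
import Summits.Schanuel.Schanuel.Theorems.DiophantineDichotomyApproximationPropertyDescentCut
import Summits.Schanuel.Schanuel.Theorems.DiophantineDichotomyApproximationPropertyCycleAPITwoLemmas
import Literature.RingTheory.MvPolynomial.LeadingExponents
import Literature.RingTheory.MvPolynomial.HomogeneousHilbertFunction
import Literature.NumberTheory.Transcendental.NesterenkoEliminationK
import HarnessLib

/-!
# Cut 3 of the clause-free `t = 3` descent: a small prime 0-cycle from a small prime space curve (crux `ApproximationProperty`, stmt-Schanuel-6117)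

Crux `stmt-Schanuel-6117` (`Summit.Schanuel.Schanuel.Theses.DiophantineDichotomy.ApproximationProperty`),
line `orbit-interpolation-determinant`, registered stub `cycleAP3Prime_of_curve`: the last cut of
Philippon's clause-free approximation property in `ℙ³` with PRIME output (`CycleAP3Prime`), FROM

* (SPC3) a small homogeneous prime space curve `𝔮 ⊇ (Q, P)` through a complete intersection
  (`(Q)` prime of degree `a ≤ Δ`, `P ∉ (Q)` of degree `b ≤ 2Δ`), `deg 𝔮 ≤ 2Δ²`, `h(𝔮) ≤ c₂ Δ Y`,
  `log |𝔮(1:ω)| ≤ −(Δ/c₂)(Δ h(𝔮) + Y deg 𝔮)` (hypothesis; neighbour stub `smallPrimeCurve3_of`);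
* (H2) the Hilbert-function lower bound `H(𝔮; ν) ≥ (ν − a − b) deg 𝔮` for `ν ≥ a + b`
  (hypothesis; neighbour stub `curveHilbert_lowerBound`).

Proof (everything proved here): the THIRD FORM `P₃ ∉ 𝔮` of degree `b₃ = a + b + ⌊Δ⌋` from the
landed box principle modulo `𝔮` (`boxPrinciple_modIdeal`, `M₃ = ⌊Δ⌋ deg 𝔮` free monomials by
(H2)) with the ADAPTIVE height `h₃ = 4(S₂ + c_B(b₃ + 1))/(⌊Δ⌋ deg 𝔮)`,
`S₂ = (Δ/c₂)(Δ h(𝔮) + Y deg 𝔮)`, so that `log ‖P₃‖_(1:ω) ≤ −S₂`; then ONE application of the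
landed descent step `small_prime_of_cut` (`m = 3`, `r = 2`, weights `(Δ, Y)`,
`U₃ = S₂ − (h(P₃) deg 𝔮 + h(𝔮) b₃ + 99 deg 𝔮 b₃) ≥ S₂/2`) and real bookkeeping with the constant
`c = 5000 (c₂ + 1)(c_B + 1)`. Proofs only; no definitions. Sources: Philippon, J. Number Theory
81 (2000) (AP1, `n = 3`); Nesterenko–Philippon (eds.), LNM 1752 (2001), Ch. 3 §4.
-/

set_option linter.dupNamespace false

noncomputable section

namespace Summit.Schanuel.Schanuel.Cruxes.ApproximationProperty.OrbitInterpolationDeterminant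

open Literature.NumberTheory.Transcendental Literature.NumberTheory.Transcendental.Nesterenko
open Literature.NumberTheory.Transcendental.PhilipponMain (cons_one_ne_zero one_le_norm_cons_one
  ringKrullDim_quotient_eq_of_isUnmixedOfRank)
open MvPolynomial Real Module
open Literature.RingTheory.MvPolynomial (idealDegree)
open scoped BigOperators

attribute [local instance] MvPolynomial.gradedAlgebra

namespace CycleAP3PrimeOfCurve

/-! ## Real arithmetic of the third cut -/

/-- The adaptive height times the degree of the curve: with `S ≤ Δ X`, `Δ ≤ 2g`, `b₃ ≤ 4Δ`,
`h₃ deg 𝔮 = 4(S + c_B(b₃ + 1))/g ≤ 8 X + 40 c_B`. [folklore] -/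
theorem h3delta_le {S X cB Δ g δ b₃ : ℝ} (hX : 0 ≤ X) (hS : S ≤ Δ * X) (hcB : 0 < cB)
    (hΔ : 1 ≤ Δ) (hg : Δ ≤ 2 * g) (hδ : 0 < δ) (hb₃ : b₃ ≤ 4 * Δ) :
    4 * (S + cB * (b₃ + 1)) / (g * δ) * δ ≤ 8 * X + 40 * cB := by
  have hg0 : 0 < g := by linarith
  have e : 4 * (S + cB * (b₃ + 1)) / (g * δ) * δ = 4 * (S + cB * (b₃ + 1)) / g := by
    rw [← div_div, div_mul_cancel₀ _ hδ.ne']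
  rw [e, div_le_iff₀ hg0]
  have h1 : 4 * (Δ * X) ≤ 4 * (2 * g * X) :=
    mul_le_mul_of_nonneg_left (mul_le_mul_of_nonneg_right hg hX) (by norm_num)
  have h2 : 4 * cB * (b₃ + 1) ≤ 4 * cB * (10 * g) :=
    mul_le_mul_of_nonneg_left (by linarith) (by linarith)
  linarith [h1, h2]

/-- The exponent of the third form: `c_B(b₃ + 1) − ((M − 4)/2) L ≤ −S` once `M = g deg 𝔮 ≥ 8`,
`h₃ (g deg 𝔮) = 4(S + c_B(b₃ + 1))` and `h₃ ≤ L`. [folklore] -/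
theorem arith_box3 {S cB b₃ M g δ L h₃ : ℝ} (hS : 0 ≤ S) (hcB : 0 < cB) (hb0 : 0 ≤ b₃)
    (hg : 0 < g) (hδ : 0 < δ) (hM : M = g * δ) (hM8 : 8 ≤ M)
    (hh₃ : h₃ * (g * δ) = 4 * (S + cB * (b₃ + 1))) (hL : h₃ ≤ L) :
    cB * (b₃ + 1) - (M - 4) / 2 * L ≤ -S := by
  have hh₃0 : 0 ≤ h₃ := by
    refine le_of_mul_le_mul_right ?_ (mul_pos hg hδ)
    rw [zero_mul, hh₃]; positivity
  have h1 : M / 4 * h₃ = S + cB * (b₃ + 1) := by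
    rw [hM]
    linear_combination hh₃ / 4
  have h2 : M / 4 * h₃ ≤ (M - 4) / 2 * L := mul_le_mul (by linarith) hL hh₃0 (by linarith)
  linarith

/-- The budget of the third cut: with `4896 c₂, 320 c_B ≤ c ≤ Δ ≤ Y`, `deg 𝔮 ≥ 1`, `b₃ ≤ 4Δ` and
`h(P₃) deg 𝔮 ≤ 8(Δ h + Y deg 𝔮) + 40 c_B`, the cost of Prop. 4.11 plus `54 deg 𝔮 b₃` is at most
`S₂/2`, `S₂ = (Δ/c₂)(Δ h + Y deg 𝔮)`. [folklore] -/
theorem arith_cut3 {c c₂ cB Δ Y δ h b₃ K S : ℝ} (hc₂ : 1 ≤ c₂) (hcc₂ : 4896 * c₂ ≤ c) (hccB : 320 * cB ≤ c) (hcΔ : c ≤ Δ) (hΔY : Δ ≤ Y) (hδ : 1 ≤ δ)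
    (hh : 0 ≤ h) (hb₃ : b₃ ≤ 4 * Δ)
    (hK : K ≤ 8 * (Δ * h + Y * δ) + 40 * cB) (hS : S = Δ / c₂ * (Δ * h + Y * δ)) :
    K + h * b₃ + 99 * δ * b₃ + 54 * δ * b₃ ≤ S / 2 := by
  have hc₂0 : 0 < c₂ := by linarith
  have hΔ0 : 0 ≤ Δ := by linarith
  have hδ0 : 0 ≤ δ := by linarith
  have hY0 : 0 ≤ Y := by linarith
  have hSc : c₂ * S = Δ * (Δ * h + Y * δ) := by rw [hS, ← mul_assoc, mul_div_cancel₀ Δ hc₂0.ne']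
  have key : 2 * c₂ * (K + h * b₃ + 99 * δ * b₃ + 54 * δ * b₃) ≤ Δ * (Δ * h + Y * δ) := by
    have p0 := mul_le_mul_of_nonneg_left hK hc₂0.le
    have p1 : 64 * c₂ * (Δ * h) ≤ Δ * (Δ * h) :=
      mul_le_mul_of_nonneg_right (by linarith) (by positivity)
    have p2 : 64 * c₂ * (Y * δ) ≤ Δ * (Y * δ) :=
      mul_le_mul_of_nonneg_right (by linarith) (by positivity)
    have hYδ : c₂ ≤ Y * δ := by
      have : Y * 1 ≤ Y * δ := mul_le_mul_of_nonneg_left hδ hY0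
      linarith
    have p3 : 320 * cB * c₂ ≤ Δ * (Y * δ) := mul_le_mul (by linarith) hYδ hc₂0.le hΔ0
    have p4 : c₂ * (h * b₃) ≤ c₂ * (h * (4 * Δ)) :=
      mul_le_mul_of_nonneg_left (mul_le_mul_of_nonneg_left hb₃ hh) hc₂0.le
    have p5 : c₂ * (δ * b₃) ≤ c₂ * (δ * (4 * Δ)) :=
      mul_le_mul_of_nonneg_left (mul_le_mul_of_nonneg_left hb₃ hδ0) hc₂0.le
    have p6 : 4896 * c₂ * (Δ * δ) ≤ Y * (Δ * δ) :=
      mul_le_mul_of_nonneg_right (by linarith) (by positivity)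
    have n1 : 0 ≤ Δ * (Δ * h) := by positivity
    have n2 : 0 ≤ Δ * (Y * δ) := by positivity
    linarith
  have h2 : c₂ * ((K + h * b₃ + 99 * δ * b₃ + 54 * δ * b₃) * 2) ≤ c₂ * S := by linarith
  have h3 := le_of_mul_le_mul_left h2 hc₂0
  rwa [le_div_iff₀ (by norm_num : (0:ℝ) < 2)]

/-- The a-priori total weight `T₃` of the components of the third cut is at most
`89 Δ (Δ h + Y deg 𝔮)`. [folklore] -/
theorem T3_le {cB Δ Y δ h hP b₃ : ℝ} (hY : 8 * cB ≤ Y) (hΔ1 : 1 ≤ Δ) (hΔY : Δ ≤ Y)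
    (hδ : 1 ≤ δ) (hh : 0 ≤ h) (hb₃ : b₃ ≤ 4 * Δ)
    (hK : hP * δ ≤ 8 * (Δ * h + Y * δ) + 40 * cB) :
    Δ * (h * b₃ + hP * δ + 18 * δ * b₃) + Y * (δ * b₃) ≤ 89 * (Δ * (Δ * h + Y * δ)) := by
  have hΔ0 : 0 ≤ Δ := by linarith
  have hδ0 : 0 ≤ δ := by linarith
  have hY0 : 0 ≤ Y := by linarith
  have q1 : h * b₃ ≤ h * (4 * Δ) := mul_le_mul_of_nonneg_left hb₃ hh
  have q2 : δ * b₃ ≤ δ * (4 * Δ) := mul_le_mul_of_nonneg_left hb₃ hδ0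
  have q3 : Δ * (Δ * δ) ≤ Y * (Δ * δ) := mul_le_mul_of_nonneg_right hΔY (by positivity)
  have q4 : 8 * cB ≤ Y * δ := by
    have : Y * 1 ≤ Y * δ := mul_le_mul_of_nonneg_left hδ hY0
    linarith
  have r1 := mul_le_mul_of_nonneg_left q1 hΔ0
  have r2 := mul_le_mul_of_nonneg_left q2 hΔ0
  have r3 := mul_le_mul_of_nonneg_left hK hΔ0
  have r4 := mul_le_mul_of_nonneg_left q2 hY0
  have r5 := mul_le_mul_of_nonneg_left q4 hΔ0
  have n1 : 0 ≤ Δ * (Δ * h) := by positivity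
  linarith

/-- The RATE of the selected prime: `2 T₃ ≤ c U₃` once `U₃ ≥ S₂/2`, `356 c₂ ≤ c`, `8 c_B ≤ c`.
[folklore] -/
theorem arith_rate3 {c c₂ cB Δ Y δ h hP b₃ S U : ℝ} (hc₂ : 1 ≤ c₂)
    (hcc₂ : 356 * c₂ ≤ c) (hccB : 8 * cB ≤ c) (hcΔ : c ≤ Δ) (hΔY : Δ ≤ Y) (hδ : 1 ≤ δ)
    (hh : 0 ≤ h) (hb₃ : b₃ ≤ 4 * Δ)
    (hK : hP * δ ≤ 8 * (Δ * h + Y * δ) + 40 * cB) (hS : S = Δ / c₂ * (Δ * h + Y * δ))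
    (hU : S / 2 ≤ U) :
    2 * (Δ * (h * b₃ + hP * δ + 18 * δ * b₃) + Y * (δ * b₃)) ≤ c * U := by
  have hc₂0 : 0 < c₂ := by linarith
  have hT := T3_le (by linarith) (by linarith) hΔY hδ hh hb₃ hK
  have hSc : c₂ * S = Δ * (Δ * h + Y * δ) := by rw [hS, ← mul_assoc, mul_div_cancel₀ Δ hc₂0.ne']
  have hΔ0 : 0 ≤ Δ := by linarith
  have hY0 : 0 ≤ Y := by linarith
  have hS0 : 0 ≤ S := by
    have h0 : c₂ * 0 ≤ c₂ * S := by rw [mul_zero, hSc]; positivity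
    exact le_of_mul_le_mul_left h0 hc₂0
  have hU0 : 0 ≤ U := by linarith
  have h1 : 356 * c₂ * U ≤ c * U := mul_le_mul_of_nonneg_right hcc₂ hU0
  have h2 : c₂ * (S / 2) ≤ c₂ * U := mul_le_mul_of_nonneg_left hU hc₂0.le
  linarith

/-- The height budget of the selected prime: `h(𝔮) b₃ + h(P₃) deg 𝔮 + 18 deg 𝔮 b₃ ≤ c Y Δ²`.
[folklore] -/
theorem arith_height3 {c c₂ cB Δ Y δ h hP b₃ : ℝ} (hc : 12 * c₂ + 40 * cB + 160 ≤ c)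
    (hcB : 0 < cB) (hΔ1 : 1 ≤ Δ) (hΔY : Δ ≤ Y) (hδ0 : 0 ≤ δ) (hδ : δ ≤ 2 * Δ ^ 2)
    (hh0 : 0 ≤ h) (hh : h ≤ c₂ * Δ * Y) (hb₃ : b₃ ≤ 4 * Δ)
    (hK : hP * δ ≤ 8 * (Δ * h + Y * δ) + 40 * cB) :
    h * b₃ + hP * δ + 18 * δ * b₃ ≤ c * Y * Δ ^ 2 := by
  have hΔ0 : 0 ≤ Δ := by linarith
  have hY0 : 0 ≤ Y := by linarith
  have hYΔ1 : 1 ≤ Y * Δ ^ 2 := one_le_mul_of_one_le_of_one_le (by linarith) (one_le_pow₀ hΔ1)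
  have s1 : h * b₃ ≤ h * (4 * Δ) := mul_le_mul_of_nonneg_left hb₃ hh0
  have s2 : Δ * h ≤ Δ * (c₂ * Δ * Y) := mul_le_mul_of_nonneg_left hh hΔ0
  have s3 : Y * δ ≤ Y * (2 * Δ ^ 2) := mul_le_mul_of_nonneg_left hδ hY0
  have s4 : δ * b₃ ≤ δ * (4 * Δ) := mul_le_mul_of_nonneg_left hb₃ hδ0
  have s5 : Δ * δ ≤ Δ * (2 * Δ ^ 2) := mul_le_mul_of_nonneg_left hδ hΔ0
  have s6 : Δ * Δ ^ 2 ≤ Y * Δ ^ 2 := mul_le_mul_of_nonneg_right hΔY (by positivity)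
  have s7 : 40 * cB * 1 ≤ 40 * cB * (Y * Δ ^ 2) := mul_le_mul_of_nonneg_left hYΔ1 (by positivity)
  have s8 : (12 * c₂ + 40 * cB + 160) * (Y * Δ ^ 2) ≤ c * (Y * Δ ^ 2) :=
    mul_le_mul_of_nonneg_right hc (by positivity)
  linarith

/-- The degree budget of the selected prime: `deg 𝔮 · b₃ ≤ 2Δ² · 4Δ ≤ (cΔ)³`. [folklore] -/
theorem arith_deg3 {c Δ δ b₃ : ℝ} (hc : 2 ≤ c) (hΔ : 0 ≤ Δ) (hδ : δ ≤ 2 * Δ ^ 2)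
    (hb0 : 0 ≤ b₃) (hb₃ : b₃ ≤ 4 * Δ) : δ * b₃ ≤ (c * Δ) ^ 3 := by
  have h4 : (2:ℝ) ^ 3 * Δ ^ 3 ≤ c ^ 3 * Δ ^ 3 :=
    mul_le_mul_of_nonneg_right (pow_le_pow_left₀ (by norm_num) hc 3) (by positivity)
  calc δ * b₃ ≤ 2 * Δ ^ 2 * (4 * Δ) := mul_le_mul hδ hb₃ hb0 (by positivity)
    _ = (2:ℝ) ^ 3 * Δ ^ 3 := by ring
    _ ≤ c ^ 3 * Δ ^ 3 := h4
    _ = (c * Δ) ^ 3 := by ring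

/-- The share of the smallness is at least the registered rate: `2T ≤ cU`, `T > 0`, `Z ≥ 0` give
`exp(−(U/(2T)) Z) ≤ exp(−Z/c)`. [folklore] -/
theorem exp_rate_le {U T Z c : ℝ} (hc : 0 < c) (hT : 0 < T) (hZ : 0 ≤ Z) (h : 2 * T ≤ c * U) :
    exp (-(U / (2 * T)) * Z) ≤ exp (-(Z / c)) := by
  rw [exp_le_exp]
  have h1 : 1 / c ≤ U / (2 * T) := by
    rw [div_le_div_iff₀ hc (by positivity)]
    linarith
  have h2 := mul_le_mul_of_nonneg_right h1 hZ
  have e : Z / c = 1 / c * Z := by ring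
  rw [e]
  linarith

/-! ## The assembly -/

/-- **Cut 3 of the clause-free descent in `ℙ³`** (curried form of the registered stub): from the
small prime space curve (SPC3) and the Hilbert lower bound (H2), for every `ω ∈ ℂ³` a constant
`c = 5000(c₂ + 1)(c_B + 1)` such that for `c ≤ Δ ≤ Y` some homogeneous prime `𝔭` of rank `1` has
`deg 𝔭 ≤ (cΔ)³`, `h(𝔭) ≤ c Y Δ²`, `log |𝔭(1:ω)| ≤ −(Δ h(𝔭) + Y deg 𝔭)/c` (third form by the box
principle modulo the curve with the adaptive height, then `small_prime_of_cut` with `m = 3`,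
`r = 2`, weights `(Δ, Y)`).
[cite: NesterenkoPhilippon2001, Ch. 3 Prop. 4.7, Prop. 4.11, Prop. 4.13 (pp. 39–41)] -/
theorem cut3
    (hS : ∀ ω : Fin 3 → ℂ, ∃ c : ℝ, 1 ≤ c ∧ ∀ Δ Y : ℝ, c ≤ Δ → Δ ≤ Y →
      ∃ (Q : Rx 3) (a : ℕ) (P : Rx 3) (b : ℕ) (𝔮 : Ideal (Rx 3)), Q ≠ 0 ∧ Q.IsHomogeneous a ∧
        1 ≤ a ∧ (a : ℝ) ≤ Δ ∧ (Ideal.span {Q}).IsPrime ∧ P.IsHomogeneous b ∧ 1 ≤ b ∧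
        (b : ℝ) ≤ 2 * Δ ∧ P ∉ Ideal.span {Q} ∧ 𝔮.IsPrime ∧
        𝔮.IsHomogeneous (homogeneousSubmodule (Fin (3 + 1)) ℚ) ∧ IsUnmixedOfRank 𝔮 2 ∧ Q ∈ 𝔮 ∧
        P ∈ 𝔮 ∧ (ideg 𝔮 2 : ℝ) ≤ 2 * Δ ^ 2 ∧ iheight 𝔮 2 ≤ c * Δ * Y ∧
        iabs 𝔮 2 (Fin.cons 1 ω) ≤ Real.exp (-(Δ / c * (Δ * iheight 𝔮 2 + Y * ideg 𝔮 2))))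
    (hH : ∀ (Q P : Rx 3) (a b : ℕ), Q ≠ 0 → Q.IsHomogeneous a → P.IsHomogeneous b → 1 ≤ a →
      1 ≤ b → (Ideal.span {Q}).IsPrime → P ∉ Ideal.span {Q} → ∀ 𝔭 : Ideal (Rx 3), 𝔭.IsPrime →
      (letI := MvPolynomial.gradedAlgebra (σ := Fin (3 + 1)) (R := ℚ);
        𝔭.IsHomogeneous (MvPolynomial.homogeneousSubmodule (Fin (3 + 1)) ℚ)) → Q ∈ 𝔭 → P ∈ 𝔭 →
      ringKrullDim (Rx 3 ⧸ 𝔭) = (2 : ℕ) → ∀ ν : ℕ, a + b ≤ ν →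
      (ν - a - b) * Literature.NumberTheory.Transcendental.Nesterenko.ideg 𝔭 2 +
        Module.finrank ℚ ↥(Literature.RingTheory.MvPolynomial.idealDegree 𝔭 ν) ≤
        Module.finrank ℚ ↥(MvPolynomial.homogeneousSubmodule (Fin (3 + 1)) ℚ ν))
    (ω : Fin 3 → ℂ) :
    ∃ c : ℝ, 1 ≤ c ∧ ∀ Δ Y : ℝ, c ≤ Δ → Δ ≤ Y → ∃ 𝔭 : Ideal (Rx 3), 𝔭.IsPrime ∧
      𝔭.IsHomogeneous (homogeneousSubmodule (Fin (3 + 1)) ℚ) ∧ IsUnmixedOfRank 𝔭 1 ∧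
      (ideg 𝔭 1 : ℝ) ≤ (c * Δ) ^ 3 ∧ iheight 𝔭 1 ≤ c * Y * Δ ^ 2 ∧
      iabs 𝔭 1 (Fin.cons 1 ω) ≤ Real.exp (-((Δ * iheight 𝔭 1 + Y * ideg 𝔭 1) / c)) := by
  classical
  obtain ⟨c₂, hc₂, hS⟩ := hS ω
  obtain ⟨cB, hcB, hBox⟩ := boxPrinciple_modIdeal 3 ω
  set ω₁ : Fin (3 + 1) → ℂ := Fin.cons 1 ω with hω₁def
  have hω₁ : ω₁ ≠ 0 := cons_one_ne_zero ω
  have hΘ : 1 ≤ ‖ω₁‖ := one_le_norm_cons_one ω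
  -- the constant
  set c : ℝ := 5000 * (c₂ + 1) * (cB + 1) with hcdef
  have hprod : 0 ≤ c₂ * cB := by positivity
  have hc5000 : 5000 ≤ c := by rw [hcdef]; nlinarith [hprod]
  have hcc₂ : 5000 * c₂ ≤ c := by rw [hcdef]; nlinarith [hprod]
  have hccB : 5000 * cB ≤ c := by rw [hcdef]; nlinarith [hprod]
  have hc1 : 1 ≤ c := by linarith
  have hc0 : 0 < c := by linarith
  refine ⟨c, hc1, fun Δ Y hΔ hY => ?_⟩
  have hΔ1 : 1 ≤ Δ := by linarith
  have hΔ0 : 0 < Δ := by linarith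
  have hY0 : 0 ≤ Y := by linarith
  have hYpos : 0 < Y := by linarith
  -- (SPC3): the small prime space curve `𝔮 ⊇ (Q, P)`
  obtain ⟨Q, a, P, b, 𝔮, hQ0, hQhom, ha1, haΔ, hQprime, hPhom, hb1, hbΔ, hPQ, hqprime, hqhom,
    hqunm, hQq, hPq, hdeg, hh, habs⟩ := hS Δ Y (by linarith) hY
  have hδ1n : 1 ≤ ideg 𝔮 2 :=
    Literature.Barriers.Schanuel.one_le_ideg_of_isPrime NesterenkoPhilippon2001_ch3_prop_4_4_holds
      (by norm_num) (by norm_num) hqprime hqhom hqunm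
  set δ : ℝ := (ideg 𝔮 2 : ℝ) with hδdef
  have hδ1 : 1 ≤ δ := by rw [hδdef]; exact_mod_cast hδ1n
  have hδ0 : 0 < δ := by linarith
  set h : ℝ := iheight 𝔮 2 with hhdef
  have hh0 : 0 ≤ h := height_nonneg _
  have hX0 : 0 ≤ Δ * h + Y * δ := by positivity
  set S₂ : ℝ := Δ / c₂ * (Δ * h + Y * δ) with hS₂def
  have hS₂0 : 0 ≤ S₂ := by rw [hS₂def]; positivity
  have hS₂X : S₂ ≤ Δ * (Δ * h + Y * δ) := by
    rw [hS₂def]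
    exact mul_le_mul_of_nonneg_right (div_le_self hΔ0.le hc₂) hX0
  -- the degree `g = ⌊Δ⌋` of the extra factor and `b₃ = a + b + g`
  obtain ⟨g, hgdef⟩ : ∃ g : ℕ, g = ⌊Δ⌋₊ := ⟨_, rfl⟩
  obtain ⟨-, hg10, hgΔ, hΔg⟩ := CycleAPITwo.floor_facts haΔ (by linarith : (10 : ℝ) ≤ Δ)
  rw [← hgdef] at hg10 hgΔ hΔg
  have hg0 : (0 : ℝ) < g := by exact_mod_cast (show 0 < g by omega)
  obtain ⟨b₃, hb₃def⟩ : ∃ b₃ : ℕ, b₃ = a + b + g := ⟨_, rfl⟩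
  have hab : a + b ≤ b₃ := by omega
  have hb₃g : b₃ - a - b = g := by omega
  have hb₃1 : 1 ≤ b₃ := by omega
  have hb₃pos : 0 < b₃ := hb₃1
  have hb₃R : (b₃ : ℝ) ≤ 4 * Δ := by rw [hb₃def]; push_cast; linarith
  have hb₃0 : (0 : ℝ) ≤ b₃ := Nat.cast_nonneg _
  -- (H2): `M₃ = g deg 𝔮` free monomials of degree `b₃` modulo `𝔮`
  have hdim : ringKrullDim (Rx 3 ⧸ 𝔮) = (2 : ℕ) :=
    ringKrullDim_quotient_eq_of_isUnmixedOfRank hqprime hqunm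
  have hHilb := hH Q P a b hQ0 hQhom hPhom ha1 hb1 hQprime hPQ 𝔮 hqprime hqhom hQq hPq hdim b₃ hab
  obtain ⟨M₃, hM₃def⟩ : ∃ M : ℕ, M = g * ideg 𝔮 2 := ⟨_, rfl⟩
  rw [hb₃g, ← hM₃def] at hHilb
  have hM₃8 : 8 ≤ M₃ := by
    have : 10 * 1 ≤ g * ideg 𝔮 2 := Nat.mul_le_mul hg10 hδ1n
    omega
  have hM₃R : (M₃ : ℝ) = (g : ℝ) * δ := by rw [hM₃def, Nat.cast_mul, hδdef]
  have hM₃8R : (8 : ℝ) ≤ M₃ := by exact_mod_cast hM₃8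
  have hfin : finrank ℚ ↥(homogeneousSubmodule (Fin (3 + 1)) ℚ b₃ ⊓ 𝔮.restrictScalars ℚ) + M₃ ≤
      finrank ℚ ↥(homogeneousSubmodule (Fin (3 + 1)) ℚ b₃) := by
    have e : finrank ℚ ↥(homogeneousSubmodule (Fin (3 + 1)) ℚ b₃ ⊓ 𝔮.restrictScalars ℚ) =
        finrank ℚ ↥(idealDegree 𝔮 b₃) := by
      rw [idealDegree, inf_comm]
    rw [e]
    omega
  have hqI : ∀ f ∈ 𝔮, ∀ d : ℕ, homogeneousComponent d f ∈ 𝔮 := fun f hf d =>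
    MvPolynomial.homogeneousComponent_mem_of_mem hqhom hf d
  -- the adaptive height `h₃` and the box `N₃ = ⌊e^{h₃}⌋`
  set h₃ : ℝ := 4 * (S₂ + cB * (b₃ + 1)) / (g * δ) with hh₃def
  have hh₃0 : 0 ≤ h₃ := by rw [hh₃def]; positivity
  have hh₃eq : h₃ * (g * δ) = 4 * (S₂ + cB * (b₃ + 1)) := by
    rw [hh₃def]
    exact div_mul_cancel₀ _ (by positivity)
  obtain ⟨N₃, hN₃def⟩ : ∃ N : ℕ, N = ⌊exp h₃⌋₊ := ⟨_, rfl⟩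
  obtain ⟨hN1, hlogN, hlogN1⟩ := CycleAPITwo.box_facts hh₃0
  rw [← hN₃def] at hN1 hlogN hlogN1
  -- the third form `P₃ ∉ 𝔮`
  obtain ⟨P₃, hP₃q, hP₃hom, hP₃1, -, hhP₃, hP₃val⟩ := hBox 𝔮 b₃ N₃ M₃ hqI hN1 (by omega) hfin
  set hP : ℝ := height P₃ with hPdef
  have hP0 : 0 ≤ hP := height_nonneg _
  have hPh₃ : hP ≤ h₃ := hhP₃.trans hlogN
  have hK : hP * δ ≤ 8 * (Δ * h + Y * δ) + 40 * cB := by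
    have h1 : hP * δ ≤ h₃ * δ := mul_le_mul_of_nonneg_right hPh₃ hδ0.le
    have h2 := h3delta_le (cB := cB) (b₃ := (b₃ : ℝ)) hX0 hS₂X hcB hΔ1 hΔg hδ0 hb₃R
    rw [← hh₃def] at h2
    linarith
  -- smallness of the third form at `ω₁`
  have hnorm : normAt ω₁ P₃ ≤ exp (-S₂) := by
    have h1 : normAt ω₁ P₃ ≤ ‖aeval ω₁ P₃‖ := by
      rw [normAt]
      exact div_le_self (norm_nonneg _) (one_le_mul_of_one_le_of_one_le hP₃1 (one_le_pow₀ hΘ))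
    refine h1.trans (hP₃val.trans (exp_le_exp.mpr ?_))
    exact arith_box3 hS₂0 hcB hb₃0 hg0 hδ0 hM₃R hM₃8R hh₃eq hlogN1
  -- the cut
  set U₃ : ℝ := S₂ - (hP * δ + h * b₃ + 99 * δ * b₃) with hU₃def
  have hcut : hP * δ + h * b₃ + 99 * δ * b₃ + 54 * δ * b₃ ≤ S₂ / 2 :=
    arith_cut3 hc₂ (by linarith) (by linarith) hΔ hY hδ1 hh0 hb₃R hK hS₂def
  have hδb : 0 ≤ δ * b₃ := by positivity
  have hU₃S : S₂ / 2 ≤ U₃ := by rw [hU₃def]; linarith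
  have hE : height P₃ * (ideg 𝔮 2 : ℝ) + iheight 𝔮 2 * (b₃ : ℝ) +
      11 * ((3 : ℕ) : ℝ) ^ 2 * (ideg 𝔮 2 : ℝ) * (b₃ : ℝ) = hP * δ + h * b₃ + 99 * δ * b₃ := by
    rw [← hPdef, ← hhdef, ← hδdef]
    push_cast
    ring
  have hsmall : max (normAt ω₁ P₃) (iabs 𝔮 2 ω₁) *
      exp (height P₃ * (ideg 𝔮 2 : ℝ) + iheight 𝔮 2 * (b₃ : ℝ) +
        11 * ((3 : ℕ) : ℝ) ^ 2 * (ideg 𝔮 2 : ℝ) * (b₃ : ℝ)) ≤ exp (-U₃) := by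
    refine CycleAPITwo.max_mul_exp_le hnorm habs ?_ ?_ <;> linarith [hE, hU₃def]
  have hU₃54 : 2 * ((3 : ℕ) : ℝ) ^ 3 * ((ideg 𝔮 2 : ℝ) * (b₃ : ℝ)) ≤ U₃ := by
    rw [← hδdef]
    norm_num
    linarith
  obtain ⟨𝔭, h𝔭prime, h𝔭hom, h𝔭unm, -, -, h𝔭deg, h𝔭h, h𝔭abs⟩ :=
    small_prime_of_cut 3 2 𝔮 P₃ b₃ ω₁ Δ Y U₃ le_rfl (by norm_num) hqprime hqhom hqunm hP₃hom hb₃1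
      hP₃q hω₁ hΔ0.le hY0 (by linarith) hsmall hU₃54
  simp only [show (2 : ℕ) - 1 = 1 from rfl] at h𝔭unm h𝔭deg h𝔭h h𝔭abs
  rw [← hPdef, ← hhdef, ← hδdef] at h𝔭h h𝔭abs
  have h𝔭h0 : 0 ≤ iheight 𝔭 1 := height_nonneg _
  refine ⟨𝔭, h𝔭prime, h𝔭hom, h𝔭unm, ?_, ?_, ?_⟩
  · -- degree budget `deg 𝔭 ≤ deg 𝔮 · b₃ ≤ 8Δ³ ≤ (cΔ)³`
    have h1 : (ideg 𝔭 1 : ℝ) ≤ δ * b₃ := by rw [hδdef]; exact_mod_cast h𝔭deg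
    exact h1.trans (arith_deg3 (by linarith) hΔ0.le hdeg hb₃0 hb₃R)
  · -- height budget
    have h1 : iheight 𝔭 1 ≤ h * b₃ + hP * δ + 18 * δ * b₃ := by
      refine h𝔭h.trans (le_of_eq ?_)
      push_cast
      ring
    exact h1.trans (arith_height3 (by linarith) hcB hΔ1 hY hδ0.le hdeg hh0 hh hb₃R hK)
  · -- accuracy at the registered rate `1/c`
    have hrate := arith_rate3 (hP := hP) hc₂ (by linarith) (by linarith) hΔ hY hδ1 hh0 hb₃R hK
      hS₂def hU₃S
    have hb₃posR : (0 : ℝ) < b₃ := by exact_mod_cast hb₃pos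
    refine h𝔭abs.trans (exp_rate_le hc0 ?_ ?_ ?_)
    · have h1 : 0 ≤ Δ * (h * b₃ + hP * δ + (3 * (2 + 1) + 3 ^ 2) * δ * b₃) := by positivity
      have h2 : 0 < Y * (δ * b₃) := mul_pos hYpos (mul_pos hδ0 hb₃posR)
      push_cast
      linarith
    · exact add_nonneg (mul_nonneg hΔ0.le h𝔭h0) (mul_nonneg hY0 (Nat.cast_nonneg _))
    · refine le_trans (le_of_eq ?_) hrate
      push_cast
      ring

end CycleAP3PrimeOfCurve

/-- **Registered stub `cycleAP3Prime_of_curve`** (crux `stmt-Schanuel-6117`, line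
`orbit-interpolation-determinant`; cut 3 of the clause-free `t = 3` descent): the small prime space
curve (SPC3, neighbour stub `smallPrimeCurve3_of`) and the curve Hilbert lower bound (H2, neighbour
stub `curveHilbert_lowerBound`) give Philippon's clause-free approximation property in `ℙ³` with
PRIME output, `CycleAP3Prime` (`CycleAP3PrimeOfCurve.cut3`).
[cite: NesterenkoPhilippon2001, Ch. 3 Prop. 4.7, Prop. 4.11, Prop. 4.13 (pp. 39–41)] -/
theorem cycleAP3Prime_of_curve : (∀ ω : Fin 3 → ℂ, ∃ c : ℝ, 1 ≤ c ∧ ∀ Δ Y : ℝ, c ≤ Δ → Δ ≤ Y → ∃ (Q : Rx 3) (a : ℕ) (P : Rx 3) (b : ℕ) (𝔮 : Ideal (Rx 3)), Q ≠ 0 ∧ Q.IsHomogeneous a ∧ 1 ≤ a ∧ (a : ℝ) ≤ Δ ∧ (Ideal.span {Q}).IsPrime ∧ P.IsHomogeneous b ∧ 1 ≤ b ∧ (b : ℝ) ≤ 2 * Δ ∧ P ∉ Ideal.span {Q} ∧ 𝔮.IsPrime ∧ 𝔮.IsHomogeneous (homogeneousSubmodule (Fin (3 + 1)) ℚ) ∧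 IsUnmixedOfRank 𝔮 2 ∧ Q ∈ 𝔮 ∧ P ∈ 𝔮 ∧ (ideg 𝔮 2 : ℝ) ≤ 2 * Δ ^ 2 ∧ iheight 𝔮 2 ≤ c * Δ * Y ∧ iabs 𝔮 2 (Fin.cons 1 ω) ≤ Real.exp (-(Δ / c * (Δ * iheight 𝔮 2 + Y * ideg 𝔮 2)))) → (∀ (Q P : Rx 3) (a b : ℕ), Q ≠ 0 → Q.IsHomogeneous a → P.IsHomogeneous b → 1 ≤ a → 1 ≤ b → (Ideal.span {Q}).IsPrime → P ∉ Ideal.span {Q} → ∀ 𝔭 : Ideal (Rx 3), 𝔭.IsPrime → (letI := MvPolynomial.gradedAlgebra (σ := Fin (3 + 1)) (R := ℚ); 𝔭.IsHomogeneous (MvPolynomial.homogeneousSubmodule (Fin (3 + 1)) ℚ)) → Q ∈ 𝔭 → P ∈ 𝔭 → ringKrullDim (Rx 3 ⧸ 𝔭) = (2 : ℕ) → ∀ ν : ℕ, a + b ≤ ν → (ν - a - b) * Literature.NumberTheory.Transcendental.Nesterenko.ideg 𝔭 2 + Module.finrank ℚ ↥(Literature.RingTheory.MvPolynomial.idealDegree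 𝔭 ν) ≤ Module.finrank ℚ ↥(MvPolynomial.homogeneousSubmodule (Fin (3 + 1)) ℚ ν)) → ∀ ω : Fin 3 → ℂ, ∃ c : ℝ, 1 ≤ c ∧ ∀ Δ Y : ℝ, c ≤ Δ → Δ ≤ Y → ∃ 𝔭 : Ideal (Rx 3), 𝔭.IsPrime ∧ 𝔭.IsHomogeneous (homogeneousSubmodule (Fin (3 + 1)) ℚ) ∧ IsUnmixedOfRank 𝔭 1 ∧ (ideg 𝔭 1 : ℝ) ≤ (c * Δ) ^ 3 ∧ iheight 𝔭 1 ≤ c * Y * Δ ^ 2 ∧ iabs 𝔭 1 (Fin.cons 1 ω) ≤ Real.exp (-((Δ * iheight 𝔭 1 + Y * ideg 𝔭 1) / c)) := by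
  intro hS hH ω
  exact CycleAP3PrimeOfCurve.cut3 hS hH ω

end Summit.Schanuel.Schanuel.Cruxes.ApproximationProperty.OrbitInterpolationDeterminant

end
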